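/-
Copyright (c) 2026 the pub-hodgecm-mathlib formalisation cell (harness21).  Prover seat hodgecm-mathlib-LH4-p04 (g7), req620 Track A «(D-RAM) FOUR-FRAME» squad
(STAGE-1b, heir LEAD F0P3a-plan (g20∕g21) T19-31∕T19-32 «row T₊ DERIVED»; dealer∕pen LH4-plan (g12∕g13) WORD #48∕#51 «(C2-lev-m_c)»; row-(2) lead LH4-p07 (g8)), 2026-09-04.
-/
import Summits.HodgeConjecture.HodgeConjecture.Theorems.F0P3cDyRamLevelsCensusOrderFormCM   -- ★ p859421 (this seat): (C2-lev) the level pieces' type-(2) census at the CM place = ★ p859229's order form (two-multiplier cells), both literal shapes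
import Summits.HodgeConjecture.HodgeConjecture.Theorems.F0P3cDyRamToricLevelCensusUnrTwoMult    -- ★ p859089 (this lineage, g6): the M∕E-unramified two-multiplier cell reduction `finsum_mem_inter_levelSetDep_eq` (§3's `hcell`)
import HarnessLib

/-!
# Crux `H413`, line LH4 «(D-RAM) FOUR-FRAME» — STAGE-1b, row (2): brick (C2-lev-guarded) «THE TYPE-(2) CENSUS OF `lev(a, b)` AT THE CM PLACE WITH GUARDED ONE-MULTIPLIER CONE CELLS,
# GUARD-GENERIC» — `cnt_{a,b}(ι_w t) = Σ_j [I₃(j)]·#levelSet(j, 0) + Σ_{b′} Σ_j [I₃(j)]·[G(j, b′)]·Σᶠ_{Λ ∈ levelSetDep(j, b′; μ₁)} f b′ j Λ` for ANY cell reduction `hcell` of this lineage's shape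

Cell `hodgecm-mathlib` (D-0151), FLOOR 0, crux item H413 = `stmt-HodgeConjecture-24833`, route of record `HCCMUnconditional`; squad F0∕P3c∕LH4; lane
`--supports stmt-HodgeConjecture-24833 --as helper` (count-neutral; pays NO tier-0 row; the STAGE-1b rows `stub_rows_transvPlus ∕ transvMinus ∕ regular` stay OPEN).
THEOREMS ONLY (no `def`, no instance, no notation, no `sorry`, default heartbeats).  Consumer: the chair's DERIVED road for row T₊, ROW (2) = the TYPE-(2) (toric) population of the two
unlabelled level pieces `lev(ℓ₀, m_c)`, `lev(ℓ₀ + 1, m_c)` (F0P3-p01 (g35) 10:05:32Z (γ); dealer WORD #48).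

THE OBJECT.  ★ p859421 (this seat) puts ★ p859229's order form AT THE CM PLACE in the token of ★ p858704 `pieceCountDictionary_levels (a b)` — cone cells are the TWO-MULTIPLIER cells
`levelSetDep(j, b′; μ₁) ∩ levelSetDep(j, b′; μ₂)`, `μ₁ = (jE ϖ)^{−a}(lam − jE u₀₀)`, `μ₂ = (jE ϖ)^{−b}((lam − 1)² − jE (u₀₀ − 1)²)`.  This lineage's ★ two-multiplier lemmas reduce every
such WEIGHTED cell to the ONE-multiplier cell of `μ₁` behind a lattice-free guard: ★ p859089 `…ToricLevelCensusUnrTwoMult.finsum_mem_inter_levelSetDep_eq` (M∕E-unramified letters,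
types U∕RamK; guard `j + b′ ≤ m₂ ∨ |ρμ₁∕μ₁ − ρμ₂∕μ₂| ≤ exp(−((j + b′) − m₂))`, `m₁ ≤ m₂`), its primed twin (`m₂ ≤ m₁`, cell of `μ₂`), and ★ p858944 `…RamMTwoMult.finsum_mem_inter_levelSetDep_eq_ramified`
(type RamM, `IsRamifiedQuadraticDatum`, guard at `exp(2m₂ − 2b′ − 2j − d_ρ)`); LH4-p07 (g8)'s ★ p859278 ∕ ★ p859305 are the abstract-frame compositions per type.  THIS FILE states the
composition ONCE, AT THE CM PLACE, GUARD-GENERIC: for any guard `G : ℕ → ℕ → Prop` (decidable) and any cell reduction `hcell : ∀ j b′, Σᶠ_{Λ ∈ cell₁ ∩ cell₂} f b′ j Λ = [G j b′]·Σᶠ_{Λ ∈ cell₁} f b′ j Λ`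
— which each of the three ★ lemmas above IS, token for token, at its type — the census `cnt_{a,b}(ι_w t)` has guarded ONE-multiplier cone cells.  (The `μ₂`-shallower case is the same
statement after `Set.inter_comm` inside `hcell`; the axis term is LH4-p07 (g8)'s (T5-P-axis) hand and is left as ★ p859229 prints it.)
* §1 `ncard_typeZero_fixed_endoGL_levels_eq_guardedForm` — hyperbolic literal `ι_w(t_h) = endoGL (γ₂, u)` (★ p859421 §1 ∘ `hcell` cell by cell).
* §2 `ncard_typeZero_fixed_conj_endoGL_levels_eq_guardedForm` — anisotropic literal `ι_w(t_a) = P₁·endoGL (γ₁, u)·P₁⁻¹`, `formCongr σ_w P₁ (Φ₃)_w = block(diag dg, η)` (★ p859421 §2 ∘ `hcell`).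
* §3 `ncard_typeZero_fixed_endoGL_levels_eq_guarded_unr` — WORKED INSTANCE: §1 with `hcell :=` ★ p859089 (M∕E-unramified tokens, `m₁ ≤ m₂`) = ★ p859278's CM-place twin, token for token.
INSTANCES OF RECORD `(a, b) := (ℓ₀, m_c), (ℓ₀ + 1, m_c)` (`m_c` a parameter, WORD #48); per type `hcell :=` the ★ lemma named above with `(j, a) := (j, b′)`, `f := f b′ j`.
HONEST LABEL.  Count-neutral lattice bookkeeping over ★ organs; no census law is stated; `HC_CM` is proved only modulo the 7 printed citations (2 remaining named inputs: hLiu418 =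
`stmt-HodgeConjecture-24832`, h413 = `stmt-HodgeConjecture-24833`) until rung 0 closes.
## References
* [Kottwitz1986BaseChangeUnits] R. E. Kottwitz, *Base change for unit elements of Hecke algebras*, Compositio Math. 60 (1986): §1 pp. 240–241.
* [Rogawski1990] J. D. Rogawski, *Automorphic Representations of Unitary Groups in Three Variables*, Ann. of Math. Stud. 123 (1990): §4.3 p. 43; §4.9 Prop. 4.9.1 (a)(b) pp. 54–55, Lemma 4.9.3 p. 56.
* [Jacobowitz1962] R. Jacobowitz, *Hermitian forms over local fields*, Amer. J. Math. 84 (1962): §4.  [Flicker1998UnitaryFL] Y. Z. Flicker, *Elementary proof of the fundamental lemma for a unitary group*, Canad. J. Math. 50 (1998): Prop. 7 p. 84.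
-/

set_option autoImplicit false

noncomputable section
namespace Summit.HodgeConjecture.HodgeConjecture.Cruxes.H413.F0P3cDyRamLevelsCensusGuardedCM

open MeasureTheory Measure NumberField IsDedekindDomain Topology Filter
open Literature.NumberTheory.Automorphic Literature.NumberTheory.Automorphic.UnitaryGroup Literature.NumberTheory.Automorphic.IntegralReduction
open Literature.NumberTheory.Rogawski1990 Literature.NumberTheory.GaloisRepresentations
open Literature.NumberTheory.Automorphic.UnitaryThreeFourFrame
open scoped Matrix MatrixGroups Classical Valued WithZero
open Literature.NumberTheory.Automorphic.UnitaryLatticeTree Literature.NumberTheory.Automorphic.HermitianLattice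
open Literature.NumberTheory.Automorphic.EllipticPlaneAsFieldLine
open Literature.NumberTheory.LocalFields.QuadraticOrder
open Summit.HodgeConjecture.HodgeConjecture.Cruxes.H413.F0P3cDyRamToricCensusDefs
open Summit.HodgeConjecture.HodgeConjecture.Cruxes.H413.F0P3cDyRamBlockCensusOrderForm
open Summit.HodgeConjecture.HodgeConjecture.Cruxes.H413.F0P3cDyRamFourFrameCensusDefs
open Summit.HodgeConjecture.HodgeConjecture.Cruxes.H413.F0P3cDyRamLevelsCensusOrderFormCM
open Summit.HodgeConjecture.HodgeConjecture.Cruxes.H413.F0P3cDyRamToricLevelCensusUnrTwoMult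

/-! ## §1 The hyperbolic literal, guarded cone cells -/

/-- **(C2-lev-guarded) AT THE CM PLACE, HYPERBOLIC SHAPE, GUARD-GENERIC.**  ★ p859421 §1's frame VERBATIM (`Γ = endoGL (γ₂, u) ∈ U(σ_w, (Φ₃)_w)`, line model `(M, jE, ρ, Θ, α; φ, lam, h)` of
`((Φ₂)_w, γ₂)`, schedules `a b`, near-`1` guards, ★ p859229's antecedents) plus a decidable guard `G` and a CELL REDUCTION `hcell : ∀ j b′, Σᶠ_{Λ ∈ levelSetDep(j,b′;μ₁) ∩ levelSetDep(j,b′;μ₂)} f b′ j Λ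
= [G j b′]·Σᶠ_{Λ ∈ levelSetDep(j,b′;μ₁)} f b′ j Λ` (this lineage's ★ `finsum_mem_inter_levelSetDep_eq` ∕ `…_eq_ramified`, token for token).  Then `cnt_{a,b}(Γ)` = ★ p859229's axis term
+ `Σ_{b′ ∈ Icc 1 R} Σ_{j<J+1} [IsOrd_j lam ∧ IsOrd_j ((jE ϖ)^{−a}(lam − 1)) ∧ IsOrd_j ((jE ϖ)^{−b}(lam − 1)²)]·[G j b′]·Σᶠ_{Λ ∈ levelSetDep(j, b′; (jE ϖ)^{−a}(lam − jE u₀₀))} f b′ j Λ`.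
[cite: Kottwitz1986BaseChangeUnits, §1 pp. 240–241] [cite: Rogawski1990, §4.3 p. 43; §4.9 Prop. 4.9.1 (a)(b) pp. 54–55] [cite: Jacobowitz1962, §4] [cite: Flicker1998UnitaryFL, Prop. 7 p. 84] -/
theorem ncard_typeZero_fixed_endoGL_levels_eq_guardedForm (L : Type) [Field L] [NumberField L] [IsCMField L]
    {v : HeightOneSpectrum (𝓞 ↥(maximalRealSubfield L))} (w : UnitaryGroup.PlacesOver L v)
    (hw : IsCMField.complexConj L • w.1 = w.1) {ϖ : (w.1.adicCompletion L)} (hϖ : Valued.v ϖ = WithZero.exp (-1 : ℤ))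
    {M : Type*} [Field M] [Valued M ℤᵐ⁰] {ρ Θ : M →+* M} {α : M} (jE : (w.1.adicCompletion L) →+* M)
    (hρρ : ∀ x, ρ (ρ x) = x) (hvρ : ∀ x, Valued.v (ρ x) = Valued.v x) (hα : ρ α ≠ α) (hα1 : Valued.v α ≤ 1)
    (hint : ∀ z : M, Valued.v z ≤ 1 → Valued.v ((z - ρ z) / (α - ρ α)) ≤ 1)
    (hΘΘ : ∀ x, Θ (Θ x) = x) (hΘρ : ∀ x, Θ (ρ x) = ρ (Θ x)) (hvΘ : ∀ x, Valued.v (Θ x) = Valued.v x)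
    (hΘj : ∀ x, Θ (jE x) = jE ((galAdicCompletionMap (L := L) (IsCMField.complexConj L) hw) x))
    (hjv : ∀ c, Valued.v (jE c) ≤ 1 ↔ Valued.v c ≤ 1) (hjfix : ∀ z, ρ z = z ↔ ∃ c, jE c = z)
    (hjpow : ∀ (t : (w.1.adicCompletion L)) (n : ℤ), Valued.v (jE t) = Valued.v (jE ϖ) ^ n ↔ Valued.v t = Valued.v ϖ ^ n)
    (hEval : ∀ c : M, ρ c = c → c ≠ 0 → Valued.v c ≤ 1 → ∃ n : ℕ, Valued.v c = Valued.v (jE ϖ) ^ n)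
    (hϖmax : ∀ t : M, ρ t = t → Valued.v t < 1 → Valued.v t ≤ Valued.v (jE ϖ))
    (φ : (Fin 2 → (w.1.adicCompletion L)) →+ M) (hφs : ∀ (c : (w.1.adicCompletion L)) (x : Fin 2 → (w.1.adicCompletion L)), φ (c • x) = jE c * φ x)
    (hφi : Function.Injective φ) (hφo : Function.Surjective φ)
    (γ₂ : GL (Fin 2) (w.1.adicCompletion L)) {lam h : M} (hφγ : ∀ x, φ ((γ₂ : Matrix (Fin 2) (Fin 2) (w.1.adicCompletion L)).mulVec x) = lam * φ x) (hlam : Valued.v lam = 1)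
    (hΘh : Θ h = h) (hh : h ≠ 0)
    (hform : ∀ x y, jE (pairing (galAdicCompletionMap (L := L) (IsCMField.complexConj L) hw) (placeForm (Matrix.of fun i j : Fin 2 => if i.val + j.val + 1 = 2 then (1 : L) else 0) w.1) x y) =
      h * Θ (φ x) * φ y + ρ (h * Θ (φ x) * φ y))
    (u : GL (Fin 1) (w.1.adicCompletion L))
    (hΓ : endoGL (γ₂, u) ∈ unitaryGroupOfForm (galAdicCompletionMap (L := L) (IsCMField.complexConj L) hw) (placeForm (Matrix.of fun i j : Fin 3 => if i.val + j.val + 1 = 3 then (1 : L) else 0) w.1))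
    (hu : Valued.v ((u : Matrix (Fin 1) (Fin 1) (w.1.adicCompletion L)) 0 0) = 1) (a b : ℕ)
    (huc : Valued.v ((u : Matrix (Fin 1) (Fin 1) (w.1.adicCompletion L)) 0 0 - 1) ≤ Valued.v ϖ ^ a)
    (huc2 : Valued.v (((u : Matrix (Fin 1) (Fin 1) (w.1.adicCompletion L)) 0 0 - 1) ^ 2) ≤ Valued.v ϖ ^ b) {R : ℕ}
    (hfinF : {M₃ : Submodule (Valued.integer (w.1.adicCompletion L)) (Fin 3 → (w.1.adicCompletion L)) |
      IsVertexLattice (galAdicCompletionMap (L := L) (IsCMField.complexConj L) hw) ϖ ((StdForm.antidiagonal 3).over (w.1.adicCompletion L)) 0 M₃ ∧ mapGL (endoGL (γ₂, u)) M₃ = M₃}.Finite)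
    (hR : ∀ M₃ : Submodule (Valued.integer (w.1.adicCompletion L)) (Fin 3 → (w.1.adicCompletion L)),
      IsVertexLattice (galAdicCompletionMap (L := L) (IsCMField.complexConj L) hw) ϖ ((StdForm.antidiagonal 3).over (w.1.adicCompletion L)) 0 M₃ →
      mapGL (endoGL (γ₂, u)) M₃ = M₃ → ∀ b' : ℕ, (∀ c : (w.1.adicCompletion L), (Pi.single 1 c : Fin 3 → (w.1.adicCompletion L)) ∈ M₃ ↔ Valued.v c ≤ Valued.v ϖ ^ b') → b' ≤ R)
    {J : ℕ} (hJ : ¬ IsOrd ρ α (jE ϖ ^ (J + 1)) lam) (hfinLS : ∀ j a', (levelSet ρ Θ α (jE ϖ) h j a').Finite)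
    (f : ℕ → ℕ → AddSubgroup M → ℕ)
    (hf : ∀ (b' j : ℕ) (Λ : AddSubgroup M) (x₀ : M) (r : (w.1.adicCompletion L)), 1 ≤ b' → x₀ ≠ 0 →
      (∀ x, x ∈ Λ ↔ ∃ z, IsOrd ρ α (jE ϖ ^ j) z ∧ x = x₀ * z) →
      IsOrd ρ α (jE ϖ ^ j) (dualGen ρ Θ α (jE ϖ ^ j) h x₀) → ¬ IsOrd ρ α (jE ϖ ^ j) (dualGen ρ Θ α (jE ϖ ^ j) h x₀ / jE ϖ) →
      Valued.v (dualGen ρ Θ α (jE ϖ ^ j) h x₀) = Valued.v (jE ϖ) ^ b' →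
      (∀ b'', (∀ x ∈ Λ, Valued.v (h * Θ x * b'' + ρ (h * Θ x * b'')) ≤ 1) → (lam - jE ((u : Matrix (Fin 1) (Fin 1) (w.1.adicCompletion L)) 0 0)) * b'' ∈ Λ) →
      IsOrd ρ α (jE ϖ ^ j) lam → jE r = glueUnit ρ Θ α (jE ϖ ^ j) h (jE ϖ) (jE 1) x₀ b' →
      f b' j Λ = Nat.card {x : 𝒪[(w.1.adicCompletion L)] ⧸ 𝓂[(w.1.adicCompletion L)] ^ (2 * b') //
        ∃ u' : 𝒪[(w.1.adicCompletion L)], Ideal.Quotient.mk (𝓂[(w.1.adicCompletion L)] ^ (2 * b')) u' = x ∧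
          Valued.v ((u' : (w.1.adicCompletion L)) * (galAdicCompletionMap (L := L) (IsCMField.complexConj L) hw) u' - r) ≤ Valued.v (ϖ ^ (2 * b'))})
    (G : ℕ → ℕ → Prop) [∀ j b', Decidable (G j b')]
    (hcell : ∀ j b', ∑ᶠ Λ ∈ levelSetDep ρ Θ α (jE ϖ) h j b' ((jE ϖ ^ a)⁻¹ * (lam - jE ((u : Matrix (Fin 1) (Fin 1) (w.1.adicCompletion L)) 0 0))) ∩
        levelSetDep ρ Θ α (jE ϖ) h j b' ((jE ϖ ^ b)⁻¹ * ((lam - 1) * (lam - 1) - jE (((u : Matrix (Fin 1) (Fin 1) (w.1.adicCompletion L)) 0 0 - 1) ^ 2))), f b' j Λ =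
      if G j b' then ∑ᶠ Λ ∈ levelSetDep ρ Θ α (jE ϖ) h j b' ((jE ϖ ^ a)⁻¹ * (lam - jE ((u : Matrix (Fin 1) (Fin 1) (w.1.adicCompletion L)) 0 0))), f b' j Λ else 0) :
    {M₃ : Submodule (Valued.integer (w.1.adicCompletion L)) (Fin 3 → (w.1.adicCompletion L)) |
        IsVertexLattice (galAdicCompletionMap (L := L) (IsCMField.complexConj L) hw) ϖ ((StdForm.antidiagonal 3).over (w.1.adicCompletion L)) 0 M₃ ∧ mapGL (endoGL (γ₂, u)) M₃ = M₃ ∧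
          (LatticeInLevel ϖ a (((endoGL (γ₂, u) : GL (Fin 3) (w.1.adicCompletion L)) : Matrix (Fin 3) (Fin 3) (w.1.adicCompletion L)) - 1) M₃ ∧
            LatticeInLevel ϖ b ((((endoGL (γ₂, u) : GL (Fin 3) (w.1.adicCompletion L)) : Matrix (Fin 3) (Fin 3) (w.1.adicCompletion L)) - 1) *
              (((endoGL (γ₂, u) : GL (Fin 3) (w.1.adicCompletion L)) : Matrix (Fin 3) (Fin 3) (w.1.adicCompletion L)) - 1)) M₃)}.ncard =
      (∑ j ∈ Finset.range (J + 1), (if IsOrd ρ α (jE ϖ ^ j) lam ∧ IsOrd ρ α (jE ϖ ^ j) ((jE ϖ ^ a)⁻¹ * (lam - 1)) ∧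
          IsOrd ρ α (jE ϖ ^ j) ((jE ϖ ^ b)⁻¹ * ((lam - 1) * (lam - 1))) then (levelSet ρ Θ α (jE ϖ) h j 0).ncard else 0)) +
        ∑ b' ∈ Finset.Icc 1 R, ∑ j ∈ Finset.range (J + 1), (if IsOrd ρ α (jE ϖ ^ j) lam ∧ IsOrd ρ α (jE ϖ ^ j) ((jE ϖ ^ a)⁻¹ * (lam - 1)) ∧
            IsOrd ρ α (jE ϖ ^ j) ((jE ϖ ^ b)⁻¹ * ((lam - 1) * (lam - 1))) then
          (if G j b' then ∑ᶠ Λ ∈ levelSetDep ρ Θ α (jE ϖ) h j b' ((jE ϖ ^ a)⁻¹ * (lam - jE ((u : Matrix (Fin 1) (Fin 1) (w.1.adicCompletion L)) 0 0))), f b' j Λ else 0) else 0) := by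
  rw [ncard_typeZero_fixed_endoGL_levels_eq_orderForm L w hw hϖ jE hρρ hvρ hα hα1 hint hΘΘ hΘρ hvΘ hΘj hjv hjfix hjpow hEval hϖmax φ hφs hφi hφo γ₂ hφγ hlam hΘh hh hform u hΓ hu a b huc huc2 hfinF hR hJ hfinLS f hf]
  congr 1
  refine Finset.sum_congr rfl fun b' _ => Finset.sum_congr rfl fun j _ => ?_
  by_cases h3 : IsOrd ρ α (jE ϖ ^ j) lam ∧ IsOrd ρ α (jE ϖ ^ j) ((jE ϖ ^ a)⁻¹ * (lam - 1)) ∧ IsOrd ρ α (jE ϖ ^ j) ((jE ϖ ^ b)⁻¹ * ((lam - 1) * (lam - 1)))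
  · rw [if_pos h3, if_pos h3, hcell j b']
  · rw [if_neg h3, if_neg h3]

/-! ## §2 The anisotropic literal, guarded cone cells -/

/-- **(C2-lev-guarded) AT THE CM PLACE, ANISOTROPIC SHAPE, GUARD-GENERIC.**  ★ p859421 §2's frame VERBATIM (`P₁·endoGL (γ₁, u)·P₁⁻¹ ∈ U(σ_w, (Φ₃)_w)`, `formCongr σ_w P₁ (Φ₃)_w =
block(diag dg, η)`, line model of `(diag dg, γ₁)`, schedules `a b`, near-`1` guards, ★ p859229's antecedents at `(H₂, h_W) := (diag dg, η)`) plus a decidable guard `G` and the cell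
reduction `hcell`: `cnt_{a,b}(P₁ΓP₁⁻¹)` = ★ p859229's axis term + the cone term with GUARDED ONE-multiplier cells `[G j b′]·Σᶠ_{Λ ∈ levelSetDep(j, b′; (jE ϖ)^{−a}(lam − jE u₀₀))} f b′ j Λ`.
[cite: Kottwitz1986BaseChangeUnits, §1 pp. 240–241] [cite: Rogawski1990, §4.9 Prop. 4.9.1 (a)(b) pp. 54–55, Lemma 4.9.3 p. 56] [cite: Jacobowitz1962, §4] [cite: Flicker1998UnitaryFL, Prop. 7 p. 84] -/
theorem ncard_typeZero_fixed_conj_endoGL_levels_eq_guardedForm (L : Type) [Field L] [NumberField L] [IsCMField L]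
    {v : HeightOneSpectrum (𝓞 ↥(maximalRealSubfield L))} (w : UnitaryGroup.PlacesOver L v)
    (hw : IsCMField.complexConj L • w.1 = w.1) {ϖ : (w.1.adicCompletion L)} (hϖ : Valued.v ϖ = WithZero.exp (-1 : ℤ))
    {M : Type*} [Field M] [Valued M ℤᵐ⁰] {ρ Θ : M →+* M} {α : M} (jE : (w.1.adicCompletion L) →+* M)
    (hρρ : ∀ x, ρ (ρ x) = x) (hvρ : ∀ x, Valued.v (ρ x) = Valued.v x) (hα : ρ α ≠ α) (hα1 : Valued.v α ≤ 1)
    (hint : ∀ z : M, Valued.v z ≤ 1 → Valued.v ((z - ρ z) / (α - ρ α)) ≤ 1)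
    (hΘΘ : ∀ x, Θ (Θ x) = x) (hΘρ : ∀ x, Θ (ρ x) = ρ (Θ x)) (hvΘ : ∀ x, Valued.v (Θ x) = Valued.v x)
    (hΘj : ∀ x, Θ (jE x) = jE ((galAdicCompletionMap (L := L) (IsCMField.complexConj L) hw) x))
    (hjv : ∀ c, Valued.v (jE c) ≤ 1 ↔ Valued.v c ≤ 1) (hjfix : ∀ z, ρ z = z ↔ ∃ c, jE c = z)
    (hjpow : ∀ (t : (w.1.adicCompletion L)) (n : ℤ), Valued.v (jE t) = Valued.v (jE ϖ) ^ n ↔ Valued.v t = Valued.v ϖ ^ n)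
    (hEval : ∀ c : M, ρ c = c → c ≠ 0 → Valued.v c ≤ 1 → ∃ n : ℕ, Valued.v c = Valued.v (jE ϖ) ^ n)
    (hϖmax : ∀ t : M, ρ t = t → Valued.v t < 1 → Valued.v t ≤ Valued.v (jE ϖ))
    (P₁ : GL (Fin 3) (w.1.adicCompletion L)) (dg : Fin 2 → (w.1.adicCompletion L)) (η : (w.1.adicCompletion L))
    (γ₁ : GL (Fin 2) (w.1.adicCompletion L)) (u : GL (Fin 1) (w.1.adicCompletion L))
    (hfc : formCongr (galAdicCompletionMap (L := L) (IsCMField.complexConj L) hw) P₁ (placeForm (Matrix.of fun i j : Fin 3 => if i.val + j.val + 1 = 3 then (1 : L) else 0) w.1) =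
      (!![(Matrix.diagonal dg) 0 0, 0, (Matrix.diagonal dg) 0 1; 0, η, 0; (Matrix.diagonal dg) 1 0, 0, (Matrix.diagonal dg) 1 1] : Matrix (Fin 3) (Fin 3) (w.1.adicCompletion L)))
    (hdg1 : ∀ i, Valued.v (dg i) = 1) (hdgσ : ∀ i, (galAdicCompletionMap (L := L) (IsCMField.complexConj L) hw) (dg i) = dg i)
    (hησ : (galAdicCompletionMap (L := L) (IsCMField.complexConj L) hw) η = η) (hη1 : Valued.v η = 1)
    (hmem : P₁ * endoGL (γ₁, u) * P₁⁻¹ ∈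
      unitaryGroupOfForm (galAdicCompletionMap (L := L) (IsCMField.complexConj L) hw) (placeForm (Matrix.of fun i j : Fin 3 => if i.val + j.val + 1 = 3 then (1 : L) else 0) w.1))
    (hu : Valued.v ((u : Matrix (Fin 1) (Fin 1) (w.1.adicCompletion L)) 0 0) = 1) (a b : ℕ)
    (huc : Valued.v ((u : Matrix (Fin 1) (Fin 1) (w.1.adicCompletion L)) 0 0 - 1) ≤ Valued.v ϖ ^ a)
    (huc2 : Valued.v (((u : Matrix (Fin 1) (Fin 1) (w.1.adicCompletion L)) 0 0 - 1) ^ 2) ≤ Valued.v ϖ ^ b)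
    (φ : (Fin 2 → (w.1.adicCompletion L)) →+ M) (hφs : ∀ (c : (w.1.adicCompletion L)) (x : Fin 2 → (w.1.adicCompletion L)), φ (c • x) = jE c * φ x)
    (hφi : Function.Injective φ) (hφo : Function.Surjective φ)
    {lam h : M} (hφγ : ∀ x, φ ((γ₁ : Matrix (Fin 2) (Fin 2) (w.1.adicCompletion L)).mulVec x) = lam * φ x) (hlam : Valued.v lam = 1)
    (hΘh : Θ h = h) (hh : h ≠ 0)
    (hform : ∀ x y, jE (pairing (galAdicCompletionMap (L := L) (IsCMField.complexConj L) hw) (Matrix.diagonal dg) x y) = h * Θ (φ x) * φ y + ρ (h * Θ (φ x) * φ y))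
    {R : ℕ}
    (hfinF : {M₃ : Submodule (Valued.integer (w.1.adicCompletion L)) (Fin 3 → (w.1.adicCompletion L)) |
      IsSelfDualLattice (galAdicCompletionMap (L := L) (IsCMField.complexConj L) hw) ϖ
        (!![(Matrix.diagonal dg) 0 0, 0, (Matrix.diagonal dg) 0 1; 0, η, 0; (Matrix.diagonal dg) 1 0, 0, (Matrix.diagonal dg) 1 1] : Matrix (Fin 3) (Fin 3) (w.1.adicCompletion L)) M₃ ∧
      mapGL (endoGL (γ₁, u)) M₃ = M₃}.Finite)
    (hR : ∀ M₃ : Submodule (Valued.integer (w.1.adicCompletion L)) (Fin 3 → (w.1.adicCompletion L)),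
      IsSelfDualLattice (galAdicCompletionMap (L := L) (IsCMField.complexConj L) hw) ϖ
        (!![(Matrix.diagonal dg) 0 0, 0, (Matrix.diagonal dg) 0 1; 0, η, 0; (Matrix.diagonal dg) 1 0, 0, (Matrix.diagonal dg) 1 1] : Matrix (Fin 3) (Fin 3) (w.1.adicCompletion L)) M₃ →
      mapGL (endoGL (γ₁, u)) M₃ = M₃ → ∀ b' : ℕ, (∀ c : (w.1.adicCompletion L), (Pi.single 1 c : Fin 3 → (w.1.adicCompletion L)) ∈ M₃ ↔ Valued.v c ≤ Valued.v ϖ ^ b') → b' ≤ R)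
    {J : ℕ} (hJ : ¬ IsOrd ρ α (jE ϖ ^ (J + 1)) lam) (hfinLS : ∀ j a', (levelSet ρ Θ α (jE ϖ) h j a').Finite)
    (f : ℕ → ℕ → AddSubgroup M → ℕ)
    (hf : ∀ (b' j : ℕ) (Λ : AddSubgroup M) (x₀ : M) (r : (w.1.adicCompletion L)), 1 ≤ b' → x₀ ≠ 0 →
      (∀ x, x ∈ Λ ↔ ∃ z, IsOrd ρ α (jE ϖ ^ j) z ∧ x = x₀ * z) →
      IsOrd ρ α (jE ϖ ^ j) (dualGen ρ Θ α (jE ϖ ^ j) h x₀) → ¬ IsOrd ρ α (jE ϖ ^ j) (dualGen ρ Θ α (jE ϖ ^ j) h x₀ / jE ϖ) →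
      Valued.v (dualGen ρ Θ α (jE ϖ ^ j) h x₀) = Valued.v (jE ϖ) ^ b' →
      (∀ b'', (∀ x ∈ Λ, Valued.v (h * Θ x * b'' + ρ (h * Θ x * b'')) ≤ 1) → (lam - jE ((u : Matrix (Fin 1) (Fin 1) (w.1.adicCompletion L)) 0 0)) * b'' ∈ Λ) →
      IsOrd ρ α (jE ϖ ^ j) lam → jE r = glueUnit ρ Θ α (jE ϖ ^ j) h (jE ϖ) (jE η) x₀ b' →
      f b' j Λ = Nat.card {x : 𝒪[(w.1.adicCompletion L)] ⧸ 𝓂[(w.1.adicCompletion L)] ^ (2 * b') //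
        ∃ u' : 𝒪[(w.1.adicCompletion L)], Ideal.Quotient.mk (𝓂[(w.1.adicCompletion L)] ^ (2 * b')) u' = x ∧
          Valued.v ((u' : (w.1.adicCompletion L)) * (galAdicCompletionMap (L := L) (IsCMField.complexConj L) hw) u' - r) ≤ Valued.v (ϖ ^ (2 * b'))})
    (G : ℕ → ℕ → Prop) [∀ j b', Decidable (G j b')]
    (hcell : ∀ j b', ∑ᶠ Λ ∈ levelSetDep ρ Θ α (jE ϖ) h j b' ((jE ϖ ^ a)⁻¹ * (lam - jE ((u : Matrix (Fin 1) (Fin 1) (w.1.adicCompletion L)) 0 0))) ∩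
        levelSetDep ρ Θ α (jE ϖ) h j b' ((jE ϖ ^ b)⁻¹ * ((lam - 1) * (lam - 1) - jE (((u : Matrix (Fin 1) (Fin 1) (w.1.adicCompletion L)) 0 0 - 1) ^ 2))), f b' j Λ =
      if G j b' then ∑ᶠ Λ ∈ levelSetDep ρ Θ α (jE ϖ) h j b' ((jE ϖ ^ a)⁻¹ * (lam - jE ((u : Matrix (Fin 1) (Fin 1) (w.1.adicCompletion L)) 0 0))), f b' j Λ else 0) :
    {M₃ : Submodule (Valued.integer (w.1.adicCompletion L)) (Fin 3 → (w.1.adicCompletion L)) |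
        IsVertexLattice (galAdicCompletionMap (L := L) (IsCMField.complexConj L) hw) ϖ ((StdForm.antidiagonal 3).over (w.1.adicCompletion L)) 0 M₃ ∧
        mapGL (P₁ * endoGL (γ₁, u) * P₁⁻¹) M₃ = M₃ ∧
          (LatticeInLevel ϖ a (((P₁ * endoGL (γ₁, u) * P₁⁻¹ : GL (Fin 3) (w.1.adicCompletion L)) : Matrix (Fin 3) (Fin 3) (w.1.adicCompletion L)) - 1) M₃ ∧
            LatticeInLevel ϖ b ((((P₁ * endoGL (γ₁, u) * P₁⁻¹ : GL (Fin 3) (w.1.adicCompletion L)) : Matrix (Fin 3) (Fin 3) (w.1.adicCompletion L)) - 1) *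
              (((P₁ * endoGL (γ₁, u) * P₁⁻¹ : GL (Fin 3) (w.1.adicCompletion L)) : Matrix (Fin 3) (Fin 3) (w.1.adicCompletion L)) - 1)) M₃)}.ncard =
      (∑ j ∈ Finset.range (J + 1), (if IsOrd ρ α (jE ϖ ^ j) lam ∧ IsOrd ρ α (jE ϖ ^ j) ((jE ϖ ^ a)⁻¹ * (lam - 1)) ∧
          IsOrd ρ α (jE ϖ ^ j) ((jE ϖ ^ b)⁻¹ * ((lam - 1) * (lam - 1))) then (levelSet ρ Θ α (jE ϖ) h j 0).ncard else 0)) +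
        ∑ b' ∈ Finset.Icc 1 R, ∑ j ∈ Finset.range (J + 1), (if IsOrd ρ α (jE ϖ ^ j) lam ∧ IsOrd ρ α (jE ϖ ^ j) ((jE ϖ ^ a)⁻¹ * (lam - 1)) ∧
            IsOrd ρ α (jE ϖ ^ j) ((jE ϖ ^ b)⁻¹ * ((lam - 1) * (lam - 1))) then
          (if G j b' then ∑ᶠ Λ ∈ levelSetDep ρ Θ α (jE ϖ) h j b' ((jE ϖ ^ a)⁻¹ * (lam - jE ((u : Matrix (Fin 1) (Fin 1) (w.1.adicCompletion L)) 0 0))), f b' j Λ else 0) else 0) := by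
  rw [ncard_typeZero_fixed_conj_endoGL_levels_eq_orderForm L w hw hϖ jE hρρ hvρ hα hα1 hint hΘΘ hΘρ hvΘ hΘj hjv hjfix hjpow hEval hϖmax P₁ dg η γ₁ u hfc hdg1 hdgσ hησ hη1 hmem hu a b huc huc2 φ hφs hφi hφo hφγ hlam hΘh hh hform hfinF hR hJ hfinLS f hf]
  congr 1
  refine Finset.sum_congr rfl fun b' _ => Finset.sum_congr rfl fun j _ => ?_
  by_cases h3 : IsOrd ρ α (jE ϖ ^ j) lam ∧ IsOrd ρ α (jE ϖ ^ j) ((jE ϖ ^ a)⁻¹ * (lam - 1)) ∧ IsOrd ρ α (jE ϖ ^ j) ((jE ϖ ^ b)⁻¹ * ((lam - 1) * (lam - 1)))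
  · rw [if_pos h3, if_pos h3, hcell j b']
  · rw [if_neg h3, if_neg h3]

/-! ## §3 Worked instance: the M∕E-unramified frame (types U ∕ RamK), hyperbolic literal — `hcell :=` ★ p859089, token for token (the CM-place twin of ★ p859278) -/

/-- **(C2-lev-guarded)_U AT THE CM PLACE, HYPERBOLIC SHAPE — the `μ₁`-shallower case (`m₁ ≤ m₂`).**  §1 with `G j b′ := (j + b′ ≤ m₂ ∨ |ρμ₁∕μ₁ − ρμ₂∕μ₂| ≤ exp(−((j + b′) − m₂)))`
and `hcell :=` ★ p859089 `finsum_mem_inter_levelSetDep_eq` under the M∕E-unramified tokens `|α − ρα| = 1`, `|jE ϖ| = exp(−1)` and the multiplier tokens `|μ₁| = exp(−m₁)`,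
`|μ₂| = exp(−m₂)` — i.e. ★ p859278 (LH4-p07 (g8)) read in ★ p858704's `pieceCountDictionary_levels` token at the CM place.  (RamM: the same term with ★ p858944
`finsum_mem_inter_levelSetDep_eq_ramified` as `hcell`; `μ₂` shallower: the primed ★ lemmas after `Set.inter_comm`.)
[cite: Kottwitz1986BaseChangeUnits, §1 pp. 240–241] [cite: Rogawski1990, §4.3 p. 43; §4.9 Prop. 4.9.1 (a)(b) pp. 54–55] [cite: Jacobowitz1962, §4] [cite: Flicker1998UnitaryFL, Prop. 7 p. 84] -/
theorem ncard_typeZero_fixed_endoGL_levels_eq_guarded_unr (L : Type) [Field L] [NumberField L] [IsCMField L]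
    {v : HeightOneSpectrum (𝓞 ↥(maximalRealSubfield L))} (w : UnitaryGroup.PlacesOver L v)
    (hw : IsCMField.complexConj L • w.1 = w.1) {ϖ : (w.1.adicCompletion L)} (hϖ : Valued.v ϖ = WithZero.exp (-1 : ℤ))
    {M : Type*} [Field M] [Valued M ℤᵐ⁰] {ρ Θ : M →+* M} {α : M} (jE : (w.1.adicCompletion L) →+* M)
    (hρρ : ∀ x, ρ (ρ x) = x) (hvρ : ∀ x, Valued.v (ρ x) = Valued.v x) (hα : ρ α ≠ α) (hα1 : Valued.v α ≤ 1)
    (hint : ∀ z : M, Valued.v z ≤ 1 → Valued.v ((z - ρ z) / (α - ρ α)) ≤ 1)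
    (hΘΘ : ∀ x, Θ (Θ x) = x) (hΘρ : ∀ x, Θ (ρ x) = ρ (Θ x)) (hvΘ : ∀ x, Valued.v (Θ x) = Valued.v x)
    (hΘj : ∀ x, Θ (jE x) = jE ((galAdicCompletionMap (L := L) (IsCMField.complexConj L) hw) x))
    (hjv : ∀ c, Valued.v (jE c) ≤ 1 ↔ Valued.v c ≤ 1) (hjfix : ∀ z, ρ z = z ↔ ∃ c, jE c = z)
    (hjpow : ∀ (t : (w.1.adicCompletion L)) (n : ℤ), Valued.v (jE t) = Valued.v (jE ϖ) ^ n ↔ Valued.v t = Valued.v ϖ ^ n)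
    (hEval : ∀ c : M, ρ c = c → c ≠ 0 → Valued.v c ≤ 1 → ∃ n : ℕ, Valued.v c = Valued.v (jE ϖ) ^ n)
    (hϖmax : ∀ t : M, ρ t = t → Valued.v t < 1 → Valued.v t ≤ Valued.v (jE ϖ))
    (φ : (Fin 2 → (w.1.adicCompletion L)) →+ M) (hφs : ∀ (c : (w.1.adicCompletion L)) (x : Fin 2 → (w.1.adicCompletion L)), φ (c • x) = jE c * φ x)
    (hφi : Function.Injective φ) (hφo : Function.Surjective φ)
    (γ₂ : GL (Fin 2) (w.1.adicCompletion L)) {lam h : M} (hφγ : ∀ x, φ ((γ₂ : Matrix (Fin 2) (Fin 2) (w.1.adicCompletion L)).mulVec x) = lam * φ x) (hlam : Valued.v lam = 1)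
    (hΘh : Θ h = h) (hh : h ≠ 0)
    (hform : ∀ x y, jE (pairing (galAdicCompletionMap (L := L) (IsCMField.complexConj L) hw) (placeForm (Matrix.of fun i j : Fin 2 => if i.val + j.val + 1 = 2 then (1 : L) else 0) w.1) x y) =
      h * Θ (φ x) * φ y + ρ (h * Θ (φ x) * φ y))
    (u : GL (Fin 1) (w.1.adicCompletion L))
    (hΓ : endoGL (γ₂, u) ∈ unitaryGroupOfForm (galAdicCompletionMap (L := L) (IsCMField.complexConj L) hw) (placeForm (Matrix.of fun i j : Fin 3 => if i.val + j.val + 1 = 3 then (1 : L) else 0) w.1))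
    (hu : Valued.v ((u : Matrix (Fin 1) (Fin 1) (w.1.adicCompletion L)) 0 0) = 1) (a b : ℕ)
    (huc : Valued.v ((u : Matrix (Fin 1) (Fin 1) (w.1.adicCompletion L)) 0 0 - 1) ≤ Valued.v ϖ ^ a)
    (huc2 : Valued.v (((u : Matrix (Fin 1) (Fin 1) (w.1.adicCompletion L)) 0 0 - 1) ^ 2) ≤ Valued.v ϖ ^ b) {R : ℕ}
    (hfinF : {M₃ : Submodule (Valued.integer (w.1.adicCompletion L)) (Fin 3 → (w.1.adicCompletion L)) |
      IsVertexLattice (galAdicCompletionMap (L := L) (IsCMField.complexConj L) hw) ϖ ((StdForm.antidiagonal 3).over (w.1.adicCompletion L)) 0 M₃ ∧ mapGL (endoGL (γ₂, u)) M₃ = M₃}.Finite)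
    (hR : ∀ M₃ : Submodule (Valued.integer (w.1.adicCompletion L)) (Fin 3 → (w.1.adicCompletion L)),
      IsVertexLattice (galAdicCompletionMap (L := L) (IsCMField.complexConj L) hw) ϖ ((StdForm.antidiagonal 3).over (w.1.adicCompletion L)) 0 M₃ →
      mapGL (endoGL (γ₂, u)) M₃ = M₃ → ∀ b' : ℕ, (∀ c : (w.1.adicCompletion L), (Pi.single 1 c : Fin 3 → (w.1.adicCompletion L)) ∈ M₃ ↔ Valued.v c ≤ Valued.v ϖ ^ b') → b' ≤ R)
    {J : ℕ} (hJ : ¬ IsOrd ρ α (jE ϖ ^ (J + 1)) lam) (hfinLS : ∀ j a', (levelSet ρ Θ α (jE ϖ) h j a').Finite)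
    (f : ℕ → ℕ → AddSubgroup M → ℕ)
    (hf : ∀ (b' j : ℕ) (Λ : AddSubgroup M) (x₀ : M) (r : (w.1.adicCompletion L)), 1 ≤ b' → x₀ ≠ 0 →
      (∀ x, x ∈ Λ ↔ ∃ z, IsOrd ρ α (jE ϖ ^ j) z ∧ x = x₀ * z) →
      IsOrd ρ α (jE ϖ ^ j) (dualGen ρ Θ α (jE ϖ ^ j) h x₀) → ¬ IsOrd ρ α (jE ϖ ^ j) (dualGen ρ Θ α (jE ϖ ^ j) h x₀ / jE ϖ) →
      Valued.v (dualGen ρ Θ α (jE ϖ ^ j) h x₀) = Valued.v (jE ϖ) ^ b' →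
      (∀ b'', (∀ x ∈ Λ, Valued.v (h * Θ x * b'' + ρ (h * Θ x * b'')) ≤ 1) → (lam - jE ((u : Matrix (Fin 1) (Fin 1) (w.1.adicCompletion L)) 0 0)) * b'' ∈ Λ) →
      IsOrd ρ α (jE ϖ ^ j) lam → jE r = glueUnit ρ Θ α (jE ϖ ^ j) h (jE ϖ) (jE 1) x₀ b' →
      f b' j Λ = Nat.card {x : 𝒪[(w.1.adicCompletion L)] ⧸ 𝓂[(w.1.adicCompletion L)] ^ (2 * b') //
        ∃ u' : 𝒪[(w.1.adicCompletion L)], Ideal.Quotient.mk (𝓂[(w.1.adicCompletion L)] ^ (2 * b')) u' = x ∧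
          Valued.v ((u' : (w.1.adicCompletion L)) * (galAdicCompletionMap (L := L) (IsCMField.complexConj L) hw) u' - r) ≤ Valued.v (ϖ ^ (2 * b'))})
    (hαv : Valued.v (α - ρ α) = 1) (hϖM : Valued.v (jE ϖ) = WithZero.exp (-1 : ℤ)) {m₁ m₂ : ℕ}
    (hm₁ : Valued.v ((jE ϖ ^ a)⁻¹ * (lam - jE ((u : Matrix (Fin 1) (Fin 1) (w.1.adicCompletion L)) 0 0))) = WithZero.exp (-(m₁ : ℤ)))
    (hm₂ : Valued.v ((jE ϖ ^ b)⁻¹ * ((lam - 1) * (lam - 1) - jE (((u : Matrix (Fin 1) (Fin 1) (w.1.adicCompletion L)) 0 0 - 1) ^ 2))) = WithZero.exp (-(m₂ : ℤ))) (hle : m₁ ≤ m₂) :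
    {M₃ : Submodule (Valued.integer (w.1.adicCompletion L)) (Fin 3 → (w.1.adicCompletion L)) |
        IsVertexLattice (galAdicCompletionMap (L := L) (IsCMField.complexConj L) hw) ϖ ((StdForm.antidiagonal 3).over (w.1.adicCompletion L)) 0 M₃ ∧ mapGL (endoGL (γ₂, u)) M₃ = M₃ ∧
          (LatticeInLevel ϖ a (((endoGL (γ₂, u) : GL (Fin 3) (w.1.adicCompletion L)) : Matrix (Fin 3) (Fin 3) (w.1.adicCompletion L)) - 1) M₃ ∧
            LatticeInLevel ϖ b ((((endoGL (γ₂, u) : GL (Fin 3) (w.1.adicCompletion L)) : Matrix (Fin 3) (Fin 3) (w.1.adicCompletion L)) - 1) *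
              (((endoGL (γ₂, u) : GL (Fin 3) (w.1.adicCompletion L)) : Matrix (Fin 3) (Fin 3) (w.1.adicCompletion L)) - 1)) M₃)}.ncard =
      (∑ j ∈ Finset.range (J + 1), (if IsOrd ρ α (jE ϖ ^ j) lam ∧ IsOrd ρ α (jE ϖ ^ j) ((jE ϖ ^ a)⁻¹ * (lam - 1)) ∧
          IsOrd ρ α (jE ϖ ^ j) ((jE ϖ ^ b)⁻¹ * ((lam - 1) * (lam - 1))) then (levelSet ρ Θ α (jE ϖ) h j 0).ncard else 0)) +
        ∑ b' ∈ Finset.Icc 1 R, ∑ j ∈ Finset.range (J + 1), (if IsOrd ρ α (jE ϖ ^ j) lam ∧ IsOrd ρ α (jE ϖ ^ j) ((jE ϖ ^ a)⁻¹ * (lam - 1)) ∧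
            IsOrd ρ α (jE ϖ ^ j) ((jE ϖ ^ b)⁻¹ * ((lam - 1) * (lam - 1))) then
          (if j + b' ≤ m₂ ∨ Valued.v (ρ ((jE ϖ ^ a)⁻¹ * (lam - jE ((u : Matrix (Fin 1) (Fin 1) (w.1.adicCompletion L)) 0 0))) / ((jE ϖ ^ a)⁻¹ * (lam - jE ((u : Matrix (Fin 1) (Fin 1) (w.1.adicCompletion L)) 0 0))) - ρ ((jE ϖ ^ b)⁻¹ * ((lam - 1) * (lam - 1) - jE (((u : Matrix (Fin 1) (Fin 1) (w.1.adicCompletion L)) 0 0 - 1) ^ 2))) / ((jE ϖ ^ b)⁻¹ * ((lam - 1) * (lam - 1) - jE (((u : Matrix (Fin 1) (Fin 1) (w.1.adicCompletion L)) 0 0 - 1) ^ 2)))) ≤ WithZero.exp (-((j + b' : ℕ) - (m₂ : ℤ))) then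
            ∑ᶠ Λ ∈ levelSetDep ρ Θ α (jE ϖ) h j b' ((jE ϖ ^ a)⁻¹ * (lam - jE ((u : Matrix (Fin 1) (Fin 1) (w.1.adicCompletion L)) 0 0))), f b' j Λ else 0) else 0) := by
  have hρϖ : ρ (jE ϖ) = jE ϖ := (hjfix _).2 ⟨ϖ, rfl⟩
  exact ncard_typeZero_fixed_endoGL_levels_eq_guardedForm L w hw hϖ jE hρρ hvρ hα hα1 hint hΘΘ hΘρ hvΘ hΘj hjv hjfix hjpow hEval hϖmax φ hφs hφi hφo γ₂ hφγ hlam hΘh hh hform u hΓ hu a b huc huc2 hfinF hR hJ hfinLS f hf _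
    (fun j b' => finsum_mem_inter_levelSetDep_eq hρρ hvρ hΘΘ hΘρ hvΘ hα1 hαv hρϖ hϖM hh hm₁ hm₂ hle j b' (f b' j))

end Summit.HodgeConjecture.HodgeConjecture.Cruxes.H413.F0P3cDyRamLevelsCensusGuardedCM

end
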